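import Summits.ABC.IUTFork.DAGC312zi
import Summits.ABC.IUTFork.Conditional.AbcOfSHwindowFreyRefutationP6
import Summits.ABC.IUTFork.Conditional.AbcOfSHwindowFreyRefutationHolds
import Summits.ABC.IUTFork.Conditional.AbcOfSHwBadMDeepFreyTier1
import Summits.ABC.IUTFork.Conditional.AbcOfSHwindowFreyRefutationP6Tier2
import Summits.ABC.IUTFork.LDHGenuinePerImageUnconditional
import Summits.ABC.IUTFork.LDHGenuinePerImageUniform
import HarnessLib

/-!
# Kernel DAG index — layer C312, part zj (Δ22): APEX STATUS CENSUS v14 — FINDINGS OF RECORD v3.0.2 §O «C:PERIMAGE-UNCOND» and v3.0.3 §P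
# «C:HSHW-REF-P6» BY NAME: (P6) is a kernel THEOREM at the 3677-triple, so the K window binder is refuted AS TYPED with NO hypothesis; the M
# window binder is provably unengaged at the same datum; the typed per-image form (P) is TRUE unconditionally at known data (one FQN for letter K2)

index Δ22 · abc-iut-c312-2 gen 7 (filer) per HOME/plan/KERNEL-DAG-SPEC.md v1.3 §4 (3) (apex duty of the index) and the one-name census pattern of
`DAG.cor312_kernel_census_v10/v11` (DAGC312ze/zf), `DAG.apex_status_v12` (DAGC312zh, Δ20) and `DAG.apex_status_v13` (DAGC312zi, Δ21). APPEND-ONLY;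
PROOF-ONLY (no `def`, no new `Prop`, no instance). THIS FILE PROVES NOTHING NEW: it conjoins the STATEMENTS of landed theorems
(`PartC312k.StatementOf @thm`) and proves the conjunction by the tuple of those theorems.

WHAT `apex_status_v14` RECORDS (each conjunct is a theorem ALREADY in the tree, cited by name; ns `Summit.ABC.IUTFork.` omitted; the words are those
of HOME/FINDINGS-OF-RECORD.md v3.0.2 §O (appended 2026-08-26T23:20:09Z, abc-iut-plan g10) and v3.0.3 §P + §O.1 (appended 2026-08-27T00:28:28Z)):
(0) `DAG.apex_status_v13` (Δ21, p469610) — CARRIED verbatim (itself carrying v12: records K `abc_of_SH_v10K_window_content` explicit 3 · stable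
    companion explicit 2 · leanest `abc_of_jointLicence_K_content` explicit 1 · γ-read explicit 1 — hypothesis-list lengths UNCHANGED this hour,
    plan/C-SCOREBOARD §5 00:55Z);
§P (1) `Conditional.condP6_thirteen` · `condP6_eleven` · `condP6_seventeen` · `condP6_nineteen` (abc-iut-w6-d102 g4, p476875; RQ7 abc-iut-w5-d167
    SOUND 00:18:23Z; identity junction abc-iut-C-cert-2 PASS 00:17:12Z) — [IUTchIV] Cor. 2.2 (ii) (P6) «the image of Gal(ℚ̄/F) → GL₂(𝔽_l) on E_F[l]
    contains SL₂(𝔽_l)» for every theta field F of P = ratPoint λ₃₆₇₇, λ₃₆₇₇ = 2·5¹⁰·13⁴/(11⁸·109²·3677³), IS A KERNEL THEOREM at l = 13, 11, 17, 19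
    (fact-free: Mazur's Frobenius certificate at the good prime 29 — #Ẽ(𝔽₂₉) = 36, a₂₉ = −6, t² + 6t + 29 rootless mod l — plus the Tate
    transvection at the multiplicative prime 7, ord₇Δ_min = 2, and degree transport [F : ℚ] ∣ 46080); this was THE ONE hypothesis of v13's items
    (1)/(1′)/(1″) («refuted MODULO (P6)»);
§P (2) `Conditional.not_hSHwBad_frey_holds` · `Conditional.not_hSHw_frey_holds` (w6-d102 g4, p477209; RQ7 w5-d167 SOUND) — the window binder
    `hSHwBad` of v12's record `abc_of_SH_v10K_window_szpiroBadAll` (p453137 = p450130 VERBATIM) and the uncut `hSHw` of `abc_of_SH_v10K_window`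
    (p447945) are FALSE for EVERY family of the free context binders and Kummer data, with NO hypothesis (= v13 (1)/(1′) at `condP6_thirteen`);
    hence the K WINDOW FAMILY p444039 → p445646/p448141 → p447945 → p449402 → p450130 → p453137 is, at this (datum, l), a set of COMPOSITION
    RECORDS WITH A FALSE HYPOTHESIS (C-cert-3 INTAKE 00:15:04Z; CERTS.tsv 06e779bcc9dc871f);
§P (3) M SIDE AT THE SAME DATUM (C-R62 junction; abc-iut-C-cert-3 g4, p478000): `Conditional.FreyTier1.not_forall_shallowM_thirteen` · `_eleven` ·
    `_seventeen` — at (ratPoint λ₃₆₇₇, l ∈ {13, 11, 17}) EVERY genuine Θ-volume datum has an M-DEEP member over 31, UNCONDITIONALLY (non-emptiness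
    from `ThetaPartII.stub_thetaData` at the (P6) theorems), so the M socket's shallowness input is FALSE there and the M window binder `hSHwBad_M`
    (p453767 / θ-variant p461893) is provably NOT ENGAGED at the one datum where the K window binder is refuted outright — M window family booked
    LIVE-UNENGAGED (neither refuted nor instantiated at known data);
§P (4) TIER 2 (abc-iut-W-ref-3 g2, row «C:HSHW-REF-P6-TIER2»): `Conditional.FreyRef.not_hSHwBad_frey_1061` (p469633; l₀ ∈ {13,17,19}) ·
    `…_463` (p469856; l₀ ∈ {7,11,17}) · `…_167` (p469975; l₀ ∈ {7,11,13}) — each ¬hSHwBad MODULO `Cor22.CondP6` at ITS OWN ratPoint — next to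
    `Conditional.FreyRef.condP6_frey1061` · `condP6_frey463` · `condP6_frey167` (p478172, ACCEPTED 00:26:08Z; RQ7 pending at filing time): the
    (P6) binder of those three apices, TYPE VERBATIM per the author, is now a theorem for exactly those primes (Frobenius certificates at p = 7 / 23 /
    19 on the Frey–Hellegouarch curves); the index conjoins the two statements side by side and composes NOTHING (a hypothesis-free tier-2 sibling
    is the author's/W-ref-3's filing, not this file's);
§O (5) THE TYPED PER-IMAGE FORM (P) IS TRUE, UNCONDITIONALLY, AT KNOWN DATA (abc-iut-s2-p4 g6): `Literature.IUT.LogVolume.Cor22.cor312PerImageOf_ratPoint_of_le`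
    (p471287; the GENERIC sufficiency: ONE real inequality in the classical invariants of q decides `T.Cor312PerImageOf` at EVERY genuine Θ-volume datum
    T of (ratPoint q, l); RQ7 aud-14 PASS/FAITHFUL 23:02:30Z) · `cor312PerImageOf_frey1061_thirteen'` · `cor312PerImageOf_reyssat_thirteen'` (two of
    its instances: λ₁₀₆₁ at l = 13, margin +0.63 nats; Reyssat 2 + 3¹⁰·109 = 23⁵ at l = 13, +2.30) · `cor312PerImageOf_ratPoint_uniform` (p476979,
    the SLOPE TEST: one inequality at l₀ decides the form for EVERY prime l ≥ l₀ off the denominator; RQ7 w5-d167 SOUND 00:18:23Z) ·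
    `cor312PerImageOf_reyssat_of_le` (its Reyssat instance: TRUE for every prime l ≥ 11, l ∉ {3, 23, 109}). WORDS OF RECORD (§O O2/O3, E-28a):
    `Cor312PerImageOf` is a `@[claim "Mochizuki2012" "disputed"]` Prop the cell never asserts; its evaluating TRUE at known data is outcome-neutral
    consistency evidence about OUR typed (P) form (it bears on the certificate programme only through the identity (P) = (U) at d_mod = 1), and
    concerns a DIFFERENT typed clause from the hull-level window clause S_H that §P refutes at the 3677-triple: at genuine data of known Szpiro-bad
    triples the hull-level window clause FAILS (§P) while the per-image inequality (P) HOLDS (§O) — consistent, different clauses.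
K2 READING AFTER Δ22 (numbers, no verdict): certificate/companion hypothesis-list lengths UNCHANGED (3 · 2 · 1 · 1); REFUTED AS TYPED WITH NO HYPOTHESIS
at a genuine datum: `hSHwBad` (p453137/p450130) and `hSHw` (p447945) at (λ₃₆₇₇, 13) [v13: modulo (P6)] — and, carried from v12, `hreg` · `hvol` ·
un-windowed `hSH`; REFUTED MODULO (P6)-now-a-theorem at 9 tier-2 (datum, l); M window binder LIVE-UNENGAGED; INHABITED AS TYPED: S_H at tame shallow
data (v13 (6)(6′)), the per-image form (P) at 11 (datum-class, l) + two infinite prime families (§O/§O.1); the number-level binders `hNumC` ·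
`hNumJointC` · `hNumPOffC` · `hregC` («open of abc-type», C-R52) are neither refuted nor discharged as typed.

HONEST FRAMING: statements about OUR typed objects; «refuted as typed» ≠ «refuted in print»; «inhabited / true as typed at known data» ≠ «true in
print»; (P6) is classical and undisputed — its kernel discharge removes an assumption of OUR certificates, it does not adjudicate IUT; the per-label
licence behind S_H is a STRONGER-THAN-PRINT sufficient form of Step (xi-f) (abc-iut-w5-d107's framing, adopted cell-wide); a cut, a junction or an
index knit discharges nothing. Nothing here asserts that abc is proved or refuted or takes a side on [IUTchIII] Cor. 3.12 / [IUTchIV] Thm. 1.10, on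
the readings (U)/(P), or on any author (Mochizuki / Scholze–Stix / Joshi / Dupuy–Hilado). typed ≠ discharged; indexed ≠ endorsed. Co-import (fresh
scan 00:29Z, HOME/staging/c312/c312-2/gen7/F1-SIDES-latest.txt): this part is on side B of breaker F1 and of F-w5d064-1 exactly like DAGC312zh/zi
(via the `Conditional/AbcOf…` chain); none of its imports is on side A. [claim: Mochizuki2012, status: disputed]
[cite: Mochizuki2012, IUTchIII Cor. 3.12 p. 173–174, Step (x) p. 181, Step (xi-f) p. 184; IUTchIV Thm. 1.10 pp. 22–31, Cor. 2.2 (ii) (P6) p. 46]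
-/

noncomputable section

namespace Summit.ABC.IUTFork.DAG

open PartC312k  -- `StatementOf h` := the statement of which `h` is the proof (landed in DAGC312k; re-types nothing, no new definition here)

/-- **APEX STATUS CENSUS v14 (Δ22; one FQN for letter K2).** The conjunction, BY NAME, of: (0) `DAG.apex_status_v13` (Δ21, carried);
§P (1) `Conditional.condP6_thirteen/eleven/seventeen/nineteen` — (P6) at ratPoint λ₃₆₇₇ is a kernel THEOREM (p476875, fact-free Frobenius certificate);
(2) `Conditional.not_hSHwBad_frey_holds` / `not_hSHw_frey_holds` — the window binders `hSHwBad` (p453137 = p450130 verbatim) and `hSHw` (p447945) are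
FALSE with NO hypothesis (p477209); (3) `Conditional.FreyTier1.not_forall_shallowM_thirteen/eleven/seventeen` — the M socket's shallowness input is
FALSE at the same datum, unconditionally: M window binder NOT engaged there (p478000); (4) tier 2: `FreyRef.not_hSHwBad_frey_1061/463/167` (modulo
(P6) at their own ratPoints; p469633/p469856/p469975) next to `FreyRef.condP6_frey1061/463/167` (those (P6) binders as theorems; p478172) — side by
side, nothing composed here; §O (5) `Cor22.cor312PerImageOf_ratPoint_of_le` + `…_frey1061_thirteen'` + `…_reyssat_thirteen'` (p471287) and
`Cor22.cor312PerImageOf_ratPoint_uniform` + `…_reyssat_of_le` (p476979) — the typed per-image form (P) is TRUE unconditionally at known data and on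
an infinite prime family at Reyssat. Proof = the tuple of those theorems; proves nothing new; «refuted / true as typed» ≠ «in print»; (P6) is
classical; no side taken. [claim: Mochizuki2012, status: disputed] -/
theorem apex_status_v14 :
    StatementOf @Summit.ABC.IUTFork.DAG.apex_status_v13 ∧
    -- §P (1): (P6) at the 3677-triple is a theorem
    (StatementOf @Summit.ABC.IUTFork.Conditional.condP6_thirteen ∧
      StatementOf @Summit.ABC.IUTFork.Conditional.condP6_eleven ∧
      StatementOf @Summit.ABC.IUTFork.Conditional.condP6_seventeen ∧
      StatementOf @Summit.ABC.IUTFork.Conditional.condP6_nineteen) ∧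
    -- §P (2): the K window binders refuted as typed, no hypothesis
    (StatementOf @Summit.ABC.IUTFork.Conditional.not_hSHwBad_frey_holds ∧
      StatementOf @Summit.ABC.IUTFork.Conditional.not_hSHw_frey_holds) ∧
    -- §P (3): M side — shallowness input false at the same datum, unconditionally
    (StatementOf @Summit.ABC.IUTFork.Conditional.FreyTier1.not_forall_shallowM_thirteen ∧
      StatementOf @Summit.ABC.IUTFork.Conditional.FreyTier1.not_forall_shallowM_eleven ∧
      StatementOf @Summit.ABC.IUTFork.Conditional.FreyTier1.not_forall_shallowM_seventeen) ∧
    -- §P (4): tier 2 — refutations modulo (P6) next to their (P6) theorems (not composed here)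
    ((StatementOf @Summit.ABC.IUTFork.Conditional.FreyRef.not_hSHwBad_frey_1061 ∧
        StatementOf @Summit.ABC.IUTFork.Conditional.FreyRef.condP6_frey1061) ∧
      (StatementOf @Summit.ABC.IUTFork.Conditional.FreyRef.not_hSHwBad_frey_463 ∧
        StatementOf @Summit.ABC.IUTFork.Conditional.FreyRef.condP6_frey463) ∧
      (StatementOf @Summit.ABC.IUTFork.Conditional.FreyRef.not_hSHwBad_frey_167 ∧
        StatementOf @Summit.ABC.IUTFork.Conditional.FreyRef.condP6_frey167)) ∧
    -- §O (5): the typed per-image form (P) true as typed at known data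
    (StatementOf @Literature.IUT.LogVolume.Cor22.cor312PerImageOf_ratPoint_of_le ∧
      StatementOf @Literature.IUT.LogVolume.Cor22.cor312PerImageOf_frey1061_thirteen' ∧
      StatementOf @Literature.IUT.LogVolume.Cor22.cor312PerImageOf_reyssat_thirteen' ∧
      StatementOf @Literature.IUT.LogVolume.Cor22.cor312PerImageOf_ratPoint_uniform ∧
      StatementOf @Literature.IUT.LogVolume.Cor22.cor312PerImageOf_reyssat_of_le) :=
  ⟨@Summit.ABC.IUTFork.DAG.apex_status_v13,
    ⟨@Summit.ABC.IUTFork.Conditional.condP6_thirteen, @Summit.ABC.IUTFork.Conditional.condP6_eleven,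
      @Summit.ABC.IUTFork.Conditional.condP6_seventeen, @Summit.ABC.IUTFork.Conditional.condP6_nineteen⟩,
    ⟨@Summit.ABC.IUTFork.Conditional.not_hSHwBad_frey_holds, @Summit.ABC.IUTFork.Conditional.not_hSHw_frey_holds⟩,
    ⟨@Summit.ABC.IUTFork.Conditional.FreyTier1.not_forall_shallowM_thirteen,
      @Summit.ABC.IUTFork.Conditional.FreyTier1.not_forall_shallowM_eleven,
      @Summit.ABC.IUTFork.Conditional.FreyTier1.not_forall_shallowM_seventeen⟩,
    ⟨⟨@Summit.ABC.IUTFork.Conditional.FreyRef.not_hSHwBad_frey_1061, @Summit.ABC.IUTFork.Conditional.FreyRef.condP6_frey1061⟩,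
      ⟨@Summit.ABC.IUTFork.Conditional.FreyRef.not_hSHwBad_frey_463, @Summit.ABC.IUTFork.Conditional.FreyRef.condP6_frey463⟩,
      ⟨@Summit.ABC.IUTFork.Conditional.FreyRef.not_hSHwBad_frey_167, @Summit.ABC.IUTFork.Conditional.FreyRef.condP6_frey167⟩⟩,
    ⟨@Literature.IUT.LogVolume.Cor22.cor312PerImageOf_ratPoint_of_le,
      @Literature.IUT.LogVolume.Cor22.cor312PerImageOf_frey1061_thirteen',
      @Literature.IUT.LogVolume.Cor22.cor312PerImageOf_reyssat_thirteen',
      @Literature.IUT.LogVolume.Cor22.cor312PerImageOf_ratPoint_uniform,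
      @Literature.IUT.LogVolume.Cor22.cor312PerImageOf_reyssat_of_le⟩⟩

/-- Δ22 corollary, BY NAME: the two statements that v13 (Δ21) recorded «modulo (P6)» — `not_hSHwBad_frey` (p467486) and `not_hSHw_frey` — now hold
with their (P6) premise supplied by the theorem `condP6_thirteen`; this is literally `not_hSHwBad_frey_holds` / `not_hSHw_frey_holds` (p477209) read
back through the census, recorded here so that letter-K2 readers find the v13 → v14 upgrade under one name. Proves nothing new; no side taken.
[claim: Mochizuki2012, status: disputed] -/
theorem apex_status_v14_window_refuted_as_typed :
    StatementOf @Summit.ABC.IUTFork.Conditional.not_hSHwBad_frey_holds ∧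
      StatementOf @Summit.ABC.IUTFork.Conditional.not_hSHw_frey_holds :=
  apex_status_v14.2.2.1

end Summit.ABC.IUTFork.DAG

end
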